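import Summits.NavierStokesRegularity.NavierStokesRegularity.Theorems.QuietScarPocketDoorHolomorphicLimit
import Summits.NavierStokesRegularity.NavierStokesRegularity.Theorems.QuietScarPocketDoorUniformRadiusUniform
import Summits.NavierStokesRegularity.NavierStokesRegularity.Theorems.QuietScarPocketDoorTerminalTrace

/-!
# QuietScarPocketDoorHolomorphicLimitTube — door S31 LEG F, plate PF-c with the LIMIT'S TUBE EXTENSION AND BOUND exposed
# (= plate F32b of ROUND-30 door S32 «CalmPocketDoor», nsreg-p1 g25 `r30/PLATE-AID-32.md` 6439ace1c538d9e1, in S31 vocabulary)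

Seat nsreg-C26-p1 g4 (S-door lane, LEAD ns-s30-p1 g2); `--supports stmt-NavierStokesRegularity-0056 --as helper`.

PF-c (`analyticOfBoundedHolomorphicLimit_holds`, ns-s29-p2 g3 p623565) concludes only that the uniform limit `v₀` of the real
slices is real-analytic.  Its proof shows more, and door S32's plate F32 needs the more: the holomorphic extensions `U t`
THEMSELVES converge, uniformly on a thinner tube, to a map `U₀` holomorphic there, with the SAME bound `K`, restricting to
`complexify ∘ v₀` on the real ball.

* `exists_tubeExtension_of_boundedHolomorphicLimit` — maps `U t` (`t ∈ (−η,0)`) holomorphic on `localComplexTube x_c R ρ` with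
  one bound `K` and real restrictions `v t → v₀` uniformly on `B(x_c,R)`; then for `r < R` there is `U₀` holomorphic on
  `localComplexTube x_c r (min (R−r) ρ / 4)`, `‖U₀‖ ≤ K` there, `U t → U₀` uniformly there, `U₀ ∘ complexify = complexify ∘ v₀`
  on `B(x_c,r)` (two-constants estimate on complex lines through real points, `norm_le_two_constants_of_real_diameter`, exactly
  as in p623565; completeness; several-variable Weierstrass `SCV.analyticOnNhd_of_tendstoLocallyUniformlyOn_of_eventually`);
* `exists_uniform_terminalTraceTube` — THE LOCAL BUILDING BLOCK OF F32: for `(r, a, M, P)` there are `ρ, K > 0` such that every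
  classical `(u,p)` (`ν = 1`) on `(a,0) × B(x_c,4r)` with `‖u‖ ≤ M`, `|p| ≤ P` has a terminal velocity trace `u₀`
  (`u t → u₀` uniformly on `B(x_c,2r)`, PF-a `terminalTraceC1_holds`) which is the real slice of a map holomorphic on
  `localComplexTube x_c r ρ` bounded by `K` (uniform radius `exists_uniform_terminalRadius` + the first theorem).

HONEST FRAME: complex-analysis / interior-analyticity bookkeeping for the S-door CRITERIA (S31, S32) on HYPOTHETICAL blow-up
profiles; item 0056 `NoTypeII` and Navier–Stokes regularity are NOT proved and stay OPEN.
-/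

noncomputable section

set_option linter.dupNamespace false

namespace Summit.NavierStokesRegularity.NavierStokesRegularity.Theorems.QuietScarPocketDoor

open MeasureTheory Set Function Filter Topology TopologicalSpace Metric
open scoped RealInnerProductSpace InnerProductSpace NNReal ENNReal Topology
open Literature.Analysis Literature.Analysis.FluidPDE
open Literature.Analysis.FunctionSpaces.EuclideanSpace (complexify complexify_apply norm_complexify continuous_complexify)
open Summit.NavierStokesRegularity.NavierStokesRegularity.Theorems.ScalingDefectPeepholeDoor
  (line_eq line_ofReal norm_le_two_constants_of_real_diameter twoConstantsExp_pos twoConstantsExp_le_one)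

/-- **Bounded holomorphic extensions with uniformly convergent real slices converge on a thinner tube.**  Maps `U t`,
`t ∈ (−η,0)`, holomorphic on `localComplexTube x_c R ρ` with one bound `K`, whose real restrictions `v t` converge uniformly on
`B(x_c,R)` to `v₀` as `t ↑ 0`: for `0 < r < R` there is `U₀`, holomorphic on the thinner tube `localComplexTube x_c r h`,
`h = min (R − r) ρ / 4`, bounded by `K` there, with `U t → U₀` uniformly on that tube and `U₀ (complexify x) = complexify (v₀ x)`
for `x ∈ B(x_c,r)`.  (Two-constants estimate on the complex lines `w ↦ x + w·e` through real points `x ∈ B(x_c,r)`, whose discs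
of radius `min (R−r) ρ` stay in the big tube: `sup_B |v t − v t'| ≤ m ⇒ ‖U t − U t'‖ ≤ m^Λ (2K+1)^{1−Λ}` on the thin tube;
completeness; several-variable Weierstrass theorem.) -/
theorem exists_tubeExtension_of_boundedHolomorphicLimit {xc : EuclideanSpace ℝ (Fin 3)} {r R ρ K η : ℝ}
    (hrR : r < R) (hρ : 0 < ρ) (hη : 0 < η)
    {U : ℝ → EuclideanSpace ℂ (Fin 3) → EuclideanSpace ℂ (Fin 3)}
    {v : ℝ → EuclideanSpace ℝ (Fin 3) → EuclideanSpace ℝ (Fin 3)} {v₀ : EuclideanSpace ℝ (Fin 3) → EuclideanSpace ℝ (Fin 3)}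
    (hUd : ∀ t ∈ Ioo (-η) 0, DifferentiableOn ℂ (U t) (localComplexTube xc R ρ))
    (hUb : ∀ t ∈ Ioo (-η) 0, ∀ z ∈ localComplexTube xc R ρ, ‖U t z‖ ≤ K)
    (hUr : ∀ t ∈ Ioo (-η) 0, ∀ x ∈ ball xc R, U t (complexify x) = complexify (v t x))
    (hcv : TendstoUniformlyOn v v₀ (𝓝[<] (0 : ℝ)) (ball xc R)) :
    ∃ U₀ : EuclideanSpace ℂ (Fin 3) → EuclideanSpace ℂ (Fin 3),
      DifferentiableOn ℂ U₀ (localComplexTube xc r (min (R - r) ρ / 4)) ∧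
      (∀ z ∈ localComplexTube xc r (min (R - r) ρ / 4), ‖U₀ z‖ ≤ K) ∧
      TendstoUniformlyOn U U₀ (𝓝[<] (0 : ℝ)) (localComplexTube xc r (min (R - r) ρ / 4)) ∧
      ∀ x ∈ ball xc r, U₀ (complexify x) = complexify (v₀ x) := by
  -- geometry
  set R₃ : ℝ := min (R - r) ρ with hR₃_def
  have hR₃ : 0 < R₃ := lt_min (by linarith) hρ
  have hR₃s : R₃ ≤ R - r := min_le_left _ _
  have hR₃ρ : R₃ ≤ ρ := min_le_right _ _
  set R' : ℝ := R₃ / 2 with hR'_def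
  have hR' : 0 < R' := by positivity
  have hR'R₃ : R' < R₃ := by rw [hR'_def]; linarith
  have hh : min (R - r) ρ / 4 = R' / 2 := by rw [hR'_def, hR₃_def]; ring
  set T' : Set (EuclideanSpace ℂ (Fin 3)) := localComplexTube xc r (R' / 2) with hT'_def
  rw [hh]
  have hT'open : IsOpen T' := isOpen_localComplexTube _ _ _
  have hT'T : T' ⊆ localComplexTube xc R ρ := by
    rintro z ⟨x, y, hx, hy, rfl⟩
    exact ⟨x, y, lt_trans hx hrR, by linarith, rfl⟩
  -- real points `x + a e`, `x ∈ B(x_c,r)`, `|a| < R₃`, lie in `B(x_c, R)`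
  have hrealball : ∀ x : EuclideanSpace ℝ (Fin 3), dist x xc < r → ∀ e : EuclideanSpace ℝ (Fin 3), ‖e‖ = 1 →
      ∀ a : ℝ, |a| < R₃ → x + a • e ∈ ball xc R := by
    intro x hx e he a ha
    rw [mem_ball]
    calc dist (x + a • e) xc ≤ dist (x + a • e) x + dist x xc := dist_triangle _ _ _
      _ = |a| + dist x xc := by rw [dist_eq_norm, add_sub_cancel_left, norm_smul, he, mul_one, Real.norm_eq_abs]
      _ < R₃ + r := by linarith
      _ ≤ R := by linarith
  -- complex lines through real points of `B(x_c,r)` stay in the big tube up to radius `R₃`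
  have hline : ∀ x : EuclideanSpace ℝ (Fin 3), dist x xc < r → ∀ e : EuclideanSpace ℝ (Fin 3), ‖e‖ = 1 →
      ∀ w : ℂ, ‖w‖ < R₃ → complexify x + w • complexify e ∈ localComplexTube xc R ρ := by
    intro x hx e he w hw
    rw [line_eq, complexify_add_I_smul_mem_localComplexTube_iff]
    refine ⟨?_, ?_⟩
    · have h := hrealball x hx e he w.re ((Complex.abs_re_le_norm w).trans_lt hw)
      rwa [mem_ball] at h
    · rw [norm_smul, he, mul_one, Real.norm_eq_abs]
      exact (Complex.abs_im_le_norm w).trans_lt (hw.trans_le hR₃ρ)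
  -- constants
  set K' : ℝ := max K 0 with hK'_def
  have hKK' : K ≤ K' := le_max_left _ _
  set M : ℝ := 2 * K' + 1 with hM_def
  have hM : 0 < M := by rw [hM_def]; linarith [le_max_right K 0]
  set μ : ℝ := 2 / Real.pi * Real.arctan (4 / 3) with hμ_def
  set Λ : ℝ := 1 - 2 / Real.pi * Real.arctan (4 / 3) with hΛ_def
  have hΛ0 : 0 < Λ := twoConstantsExp_pos
  -- KEY: the two-constants estimate on `T'`
  have hkey : ∀ t ∈ Ioo (-η) 0, ∀ t' ∈ Ioo (-η) 0, ∀ m : ℝ, 0 ≤ m → m ≤ M →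
      (∀ x ∈ ball xc R, ‖v t x - v t' x‖ ≤ m) → ∀ z ∈ T', ‖U t z - U t' z‖ ≤ m ^ Λ * M ^ μ := by
    intro t ht t' ht' m hm0 hmM hvm z hz
    obtain ⟨x, y, hx, hy, rfl⟩ := hz
    -- the direction `e` and the parameter `ζ` with `x + iy = x + ζ e`, `|ζ| ≤ R'/2`
    obtain ⟨e, ζ, he, hζ, hzeq⟩ : ∃ e : EuclideanSpace ℝ (Fin 3), ∃ ζ : ℂ, ‖e‖ = 1 ∧ ‖ζ‖ ≤ R' / 2 ∧
        complexify x + Complex.I • complexify y = complexify x + ζ • complexify e := by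
      by_cases hy0 : y = 0
      · refine ⟨EuclideanSpace.basisFun (Fin 3) ℝ 0, 0, (EuclideanSpace.basisFun (Fin 3) ℝ).orthonormal.1 0,
          by rw [norm_zero]; positivity, ?_⟩
        simp [hy0]
      · have hypos : 0 < ‖y‖ := norm_pos_iff.2 hy0
        refine ⟨‖y‖⁻¹ • y, (‖y‖ : ℂ) * Complex.I, ?_, ?_, ?_⟩
        · rw [norm_smul, norm_inv, norm_norm, inv_mul_cancel₀ hypos.ne']
        · rw [norm_mul, Complex.norm_real, Complex.norm_I, mul_one, Real.norm_of_nonneg hypos.le]; exact hy.le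
        · have hne : ((‖y‖ : ℝ) : ℂ) ≠ 0 := by exact_mod_cast hypos.ne'
          rw [LinearIsometry.map_smul, ← Complex.coe_smul, smul_smul, mul_comm, ← mul_assoc, Complex.ofReal_inv,
            inv_mul_cancel₀ hne, one_mul]
    -- the restriction of `U t − U t'` to the line
    set g : ℂ → EuclideanSpace ℂ (Fin 3) :=
      fun w => U t (complexify x + w • complexify e) - U t' (complexify x + w • complexify e) with hg_def
    have hΦd : Differentiable ℂ fun w : ℂ => complexify x + w • complexify e :=
      (differentiable_id.smul_const _).const_add _
    have hmaps : ∀ w : ℂ, ‖w‖ < R₃ → complexify x + w • complexify e ∈ localComplexTube xc R ρ := hline x hx e he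
    have hgd : DifferentiableOn ℂ g (ball (((0 : ℝ) : ℂ)) R₃) := by
      have hsub : MapsTo (fun w : ℂ => complexify x + w • complexify e) (ball (((0 : ℝ) : ℂ)) R₃)
          (localComplexTube xc R ρ) := fun w hw => hmaps w (by simpa using hw)
      exact ((hUd t ht).comp hΦd.differentiableOn hsub).sub ((hUd t' ht').comp hΦd.differentiableOn hsub)
    have hgM : ∀ w : ℂ, ‖w - ((0 : ℝ) : ℂ)‖ ≤ R' → ‖g w‖ ≤ M := by
      intro w hw
      have hwR₃ : ‖w‖ < R₃ := by
        rw [Complex.ofReal_zero, sub_zero] at hw; exact hw.trans_lt hR'R₃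
      have hmem := hmaps w hwR₃
      calc ‖g w‖ ≤ ‖U t (complexify x + w • complexify e)‖ + ‖U t' (complexify x + w • complexify e)‖ :=
            norm_sub_le _ _
        _ ≤ K + K := add_le_add (hUb t ht _ hmem) (hUb t' ht' _ hmem)
        _ ≤ M := by rw [hM_def]; linarith
    have hgm : ∀ a : ℝ, |a - 0| < R' → ‖g a‖ ≤ m := by
      intro a ha
      rw [sub_zero] at ha
      have hmem : x + a • e ∈ ball xc R := hrealball x hx e he a (ha.trans hR'R₃)
      simp only [hg_def, line_ofReal]
      rw [hUr t ht _ hmem, hUr t' ht' _ hmem, ← map_sub, norm_complexify]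
      exact hvm _ hmem
    have h2c := norm_le_two_constants_of_real_diameter (c := (0 : ℝ)) (R := R') (R₃ := R₃) (m := m) (K := M)
      hR' hR'R₃ hgd hm0 hmM hgM hgm (w := ζ) (by rw [Complex.ofReal_zero, sub_zero]; exact hζ)
    rw [← hΛ_def, ← hμ_def] at h2c
    rw [hzeq]
    simpa only [hg_def] using h2c
  -- smallness of `m ^ Λ * M ^ μ`
  have hsmall : ∀ ε : ℝ, 0 < ε → ∃ m : ℝ, 0 < m ∧ m ≤ M ∧ m ^ Λ * M ^ μ < ε := by
    intro ε hε
    have hMμ : 0 < M ^ μ := Real.rpow_pos_of_pos hM _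
    set a : ℝ := ε / (2 * M ^ μ) with ha_def
    have ha : 0 < a := by positivity
    refine ⟨min M (a ^ Λ⁻¹), lt_min hM (Real.rpow_pos_of_pos ha _), min_le_left _ _, ?_⟩
    have h1 : (min M (a ^ Λ⁻¹)) ^ Λ ≤ (a ^ Λ⁻¹) ^ Λ :=
      Real.rpow_le_rpow (le_min hM.le (Real.rpow_nonneg ha.le _)) (min_le_right _ _) hΛ0.le
    rw [Real.rpow_inv_rpow ha.le hΛ0.ne'] at h1
    calc (min M (a ^ Λ⁻¹)) ^ Λ * M ^ μ ≤ a * M ^ μ := mul_le_mul_of_nonneg_right h1 hMμ.le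
      _ = ε / 2 := by rw [ha_def]; field_simp
      _ < ε := by linarith
  -- `(U t)` is uniformly Cauchy on `T'` as `t ↑ 0`
  have hIoo : Ioo (-η) 0 ∈ 𝓝[<] (0 : ℝ) := Ioo_mem_nhdsLT (by linarith)
  have hC : UniformCauchySeqOn U (𝓝[<] (0 : ℝ)) T' := by
    intro u hu
    obtain ⟨ε, hε, hεu⟩ := Metric.mem_uniformity_dist.1 hu
    obtain ⟨m, hm0, hmM, hmε⟩ := hsmall ε hε
    have hvC := hcv.uniformCauchySeqOn _ (Metric.dist_mem_uniformity hm0)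
    have hI : ∀ᶠ p in (𝓝[<] (0 : ℝ)) ×ˢ (𝓝[<] (0 : ℝ)), p.1 ∈ Ioo (-η) 0 ∧ p.2 ∈ Ioo (-η) 0 :=
      Filter.prod_mem_prod hIoo hIoo
    filter_upwards [hvC, hI] with p hp hpI z hz
    apply hεu
    rw [dist_eq_norm]
    refine lt_of_le_of_lt (hkey p.1 hpI.1 p.2 hpI.2 m hm0.le hmM (fun x hx => ?_) z hz) hmε
    have h : dist (v p.1 x) (v p.2 x) < m := hp x hx
    rw [← dist_eq_norm]; exact h.le
  -- pointwise limits on `T'` (completeness) and the limit map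
  have hex : ∀ z ∈ T', ∃ w, Tendsto (fun t => U t z) (𝓝[<] (0 : ℝ)) (𝓝 w) := by
    intro z hz
    apply cauchy_map_iff_exists_tendsto.1
    rw [cauchy_map_iff', Metric.uniformity_basis_dist.tendsto_right_iff]
    intro ε hε
    exact (hC _ (Metric.dist_mem_uniformity hε)).mono fun p hp => hp z hz
  set U₀ : EuclideanSpace ℂ (Fin 3) → EuclideanSpace ℂ (Fin 3) :=
    fun z => limUnder (𝓝[<] (0 : ℝ)) (fun t => U t z) with hU₀_def
  have hU₀ : ∀ z ∈ T', Tendsto (fun t => U t z) (𝓝[<] (0 : ℝ)) (𝓝 (U₀ z)) :=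
    fun z hz => tendsto_nhds_limUnder (hex z hz)
  have hunif : TendstoUniformlyOn U U₀ (𝓝[<] (0 : ℝ)) T' := hC.tendstoUniformlyOn_of_tendsto hU₀
  have hA : AnalyticOnNhd ℂ U₀ T' :=
    Literature.Analysis.Complex.SCV.analyticOnNhd_of_tendstoLocallyUniformlyOn_of_eventually hT'open
      (mem_of_superset hIoo fun t ht => (hUd t ht).mono hT'T) hunif.tendstoLocallyUniformlyOn
  -- the bound passes to the limit
  have hbound : ∀ z ∈ T', ‖U₀ z‖ ≤ K := by
    intro z hz
    refine le_of_tendsto (hU₀ z hz).norm ?_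
    filter_upwards [hIoo] with t ht
    exact hUb t ht z (hT'T hz)
  -- the limit restricts to `complexify ∘ v₀` on `B(x_c, r)`
  have hreal : ∀ x ∈ ball xc r, U₀ (complexify x) = complexify (v₀ x) := by
    intro x hx
    rw [mem_ball] at hx
    have hxT' : complexify x ∈ T' := complexify_mem_localComplexTube (by positivity) hx
    have hxB : x ∈ ball xc R := mem_ball.2 (lt_trans hx hrR)
    have h1 := hU₀ _ hxT'
    have h2 : Tendsto (fun t => U t (complexify x)) (𝓝[<] (0 : ℝ)) (𝓝 (complexify (v₀ x))) := by
      have hv : Tendsto (fun t => complexify (v t x)) (𝓝[<] (0 : ℝ)) (𝓝 (complexify (v₀ x))) :=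
        (continuous_complexify.tendsto _).comp (hcv.tendsto_at hxB)
      refine hv.congr' ?_
      filter_upwards [hIoo] with t ht
      exact (hUr t ht x hxB).symm
    exact tendsto_nhds_unique h1 h2
  exact ⟨U₀, hA.differentiableOn, hbound, hunif, hreal⟩

/-- **The local building block of door S32's plate F32 — UNIFORM TERMINAL TRACE TUBE.**  For `(r, a, M, P)` there are
`ρ, K > 0` such that EVERY classical `(u,p)` (`ν = 1`, no force) on `(a,0) × B(x_c,4r)` with `‖u‖ ≤ M`, `|p| ≤ P` has a terminal
velocity trace `u₀` — `u t → u₀` uniformly on `B(x_c,2r)` as `t ↑ 0` (PF-a `terminalTraceC1_holds`) — which is the real slice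
of a map `U₀` holomorphic on `localComplexTube x_c r ρ` and bounded there by `K` (uniform radius `exists_uniform_terminalRadius`
on `B(x_c,2r)` + `exists_tubeExtension_of_boundedHolomorphicLimit`).
[cite: BradshawGrujicKukavica2015, Thm. 2.3 and (4.9) p. 19; SereginSverak2009, §2 p. 8] -/
theorem exists_uniform_terminalTraceTube {r a M P : ℝ} (hr : 0 < r) (ha : a < 0) (hM0 : 0 ≤ M) (hP0 : 0 ≤ P) :
    ∃ ρ K : ℝ, 0 < ρ ∧ 0 < K ∧
      ∀ (xc : EuclideanSpace ℝ (Fin 3)) (u : ℝ → EuclideanSpace ℝ (Fin 3) → EuclideanSpace ℝ (Fin 3))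
        (p : ℝ → EuclideanSpace ℝ (Fin 3) → ℝ),
        IsClassicalNSSolutionOnRegion (Ioo a 0 ×ˢ ball xc (4 * r)) 1 0 u p →
        (∀ t ∈ Ioo a 0, ∀ x ∈ ball xc (4 * r), ‖u t x‖ ≤ M) →
        (∀ t ∈ Ioo a 0, ∀ x ∈ ball xc (4 * r), |p t x| ≤ P) →
        ∃ (u₀ : EuclideanSpace ℝ (Fin 3) → EuclideanSpace ℝ (Fin 3))
          (U₀ : EuclideanSpace ℂ (Fin 3) → EuclideanSpace ℂ (Fin 3)),
          TendstoUniformlyOn (fun t => u t) u₀ (𝓝[<] (0 : ℝ)) (ball xc (2 * r)) ∧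
          DifferentiableOn ℂ U₀ (localComplexTube xc r ρ) ∧
          (∀ z ∈ localComplexTube xc r ρ, ‖U₀ z‖ ≤ K) ∧
          ∀ x ∈ ball xc r, U₀ (complexify x) = complexify (u₀ x) := by
  obtain ⟨ρ₁, K, η, hρ₁, hK, hη, hrad⟩ := exists_uniform_terminalRadius hr ha hM0 hP0
  have h2r : 0 < 2 * r - r := by linarith
  refine ⟨min (2 * r - r) ρ₁ / 4, K, by positivity, hK, fun xc u p hsol hM hP => ?_⟩
  obtain ⟨u₀, -, hcu, -⟩ := terminalTraceC1_holds xc r a M P hr ha hM0 hP0 u p hsol hM hP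
  have hU := hrad xc u p hsol hM hP
  choose! U hUd hUb hUr using hU
  obtain ⟨U₀, hd, hb, -, hrl⟩ := exists_tubeExtension_of_boundedHolomorphicLimit (r := r) (R := 2 * r) (by linarith)
    hρ₁ hη hUd hUb hUr hcu
  exact ⟨u₀, U₀, hcu, hd, hb, hrl⟩

end Summit.NavierStokesRegularity.NavierStokesRegularity.Theorems.QuietScarPocketDoor

end
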